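import Summits.CriticalPhenomena.PercolationContinuityZ3.Theorems.PercNearOneGluingNoHeavyQuantShapeHubGeneral
import HarnessLib

/-!
# QUANT lane R8, T-DEC: THE SUB-FLOOR HUB OF SHAPE `{lo, lo+K; γ}` FOR EVERY `lo < K ≤ 2lo`, WIDE PART — `S(γ₁) ∗ … ∗ S(γ_j)` is SDEC for EVERY
# width `j ≥ 4` whenever `lo ≤ Kγᵢ`, `γᵢ < 1`, `x(lo+K) ≤ lo + Kγᵢ` (census-1 gen 32; extends census-1 g31's `sdec_sHub`, which needed `2K ≤ 3lo`)

builds on p205010 (kernel theorem, internal audit signed; external expert review pending)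

Support file (`--supports stmt-CriticalPhenomena-4575`), QUANT lane seat prim-quant-census-1 (gen 32); memo
`run/shared/lean/prim/quant/prim-quant-census-1/g32/TWOLO-G32.md` §1.  Theorems only (no definitions), standard axioms, no sorries.  Uses
`sHub` / `sHub_laws` / `sHub_struct` (`…QuantShapeHubLaws`), `sdec_of_nearRoutes_charged` / `cap_of_routeBound` (`…QuantNearRouteShape`,
`…QuantNearRouteCertificate`), `shape_chain` / `shape_sum_bounds` (`…QuantShapeHubGeneral`), `choose_ge_of_between` (`…QuantSubfloorHubGeneral`).

WHY.  g31's progression criterion `sdec_progressionLK` carries the global hypothesis `2K ≤ 3lo`, but its proof uses it at ONE place: the nearness of the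
route `l ↦ l + K⌈3(T−2l)/(2K)⌉`, which needs exactly `(lo+K)j + 2K ≤ 4lo·j` (i.e. `(3lo − K)j ≥ 2K`).  For `K ≤ 2lo` this holds from width `j = 4` on
(`(3lo−K)·4 ≥ 4lo ≥ 2K`), and the binomial bookkeeping of the route bound survives with `4s < j` (lows) and `4r + 12s ≤ 3j + 3` (routes) in place of
`6s < j`, `2r + 6s < j + 2`.  So the hub of EVERY shape `lo < K ≤ 2lo` is SDEC at every width `j ≥ 4` by the SAME certificate (one near route per charged
low, credit gate `≤ 2/3`, likelihood-ratio route bound `R = 2·max(1, x/(2(1−x))) ≤ 2·min odds`); widths 2 and 3 are `…QuantShapeHubNarrow`.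
* **`sdec_progressionLK_wide`** — `sdec_progressionLK` with `2K ≤ 3lo` replaced by the nearness inequality `(lo+K)j + 2K ≤ 4lo·j` (verbatim otherwise).
* **`sHub_routeBound_twoLo`** — the route bound `2o·u(l) ≤ u(l + Kr)` for `K ≤ 2lo`, `|P| ≥ 4` (charged `l`, `2l < (lo+K)|P|`, `r ≥ 1`,
  `2Kr + 6l < 3(lo+K)|P| + 2K`).
* **`sdec_sHub_wide`** — `lo < K ≤ 2lo`; ∀ `P` with `4 ≤ |P|` and `lo ≤ Kγ`, `γ < 1`, `x(lo+K) ≤ lo + Kγ` for `γ ∈ P`; `0 < x` ⟹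
  **`SDEC x ((lo+K)|P|) (sHub lo K P)`**.
Numerics (memo §1, code/exp22.py, exact rationals): shapes (1,2), (2,3), (2,4), (3,4), (3,5), (3,6), (4,5), (4,6), (4,7), (4,8), widths 4–7, 5-point gate
grids from `lo/K` to `255/256` asymmetric: 0 failures of nearness / range / distinctness / capacity / route bound / odds / floor / index conditions.

HONEST STATUS.  A shape-general SDEC family of hubs; `SiblingStep`, `GluedDominatedMass`, `SDECConvClosed`, `FarTreeRow` OPEN; RATE class (log\*) /
honest sentence of `run/shared/lean/prim/quant/README.md` unchanged.  [this work].  Nothing here is cited as a published result.  The gluing rows served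
[cite: KozmaNitzan2024, Conjecture 3 (p. 15)]; product measure [cite: Grimmett1999, §1.3 p. 10].
-/

noncomputable section

open scoped BigOperators

namespace Summit.CriticalPhenomena.PercolationContinuityZ3.Theorems
namespace Quant
namespace LawDec

open Finset

/-! ### The progression criterion with the nearness inequality as hypothesis -/

/-- **THE PROGRESSION CRITERION FOR THE SHAPE `(lo, K)`, WIDE FORM** (`lo < K`, width `j` with `(lo+K)j + 2K ≤ 4lo·j`): `μ` a probability law on
`{0..(lo+K)j}` charging only atoms `lo·j + K·s`, mean `T₀ < (lo+K)j`, floor `0 < x < 1` with `x·(lo+K)j ≤ T₀`; `R ≥ 2` with `x(1+R) ≤ R`; ROUTE BOUND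
`R·μ l ≤ μ(l+Kr)` for every charged `l` with `2l < T₀` and every `r ≥ 1` with `2K(r−1) < 3(T₀ − 2l)`.  Then `SDEC x ((lo+K)j) μ` (route map
`l ↦ l + K⌈3(T−2l)/(2K)⌉`, as in `sdec_progressionLK`, whose hypothesis `2K ≤ 3lo` served only to give the nearness inequality). [this work] -/
theorem sdec_progressionLK_wide (lo K j : ℕ) (x T₀ R : ℝ) (μ : ℕ → ℝ) (hloK : lo < K)
    (hwide : ((lo : ℝ) + K) * j + 2 * K ≤ 4 * ((lo : ℝ) * j))
    (hx0 : 0 < x) (hx1 : x < 1)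
    (hμ0 : ∀ h, 0 ≤ μ h) (hμM : ∀ h, (lo + K) * j < h → μ h = 0) (hμ1 : ∑ h ∈ Finset.range ((lo + K) * j + 1), μ h = 1)
    (hT : ∑ h ∈ Finset.range ((lo + K) * j + 1), (h : ℝ) * μ h = T₀) (hT0 : 0 < T₀) (hTtop : T₀ < ((lo : ℝ) + K) * j)
    (hta : x * (((lo + K) * j : ℕ) : ℝ) ≤ T₀) (hsupp : ∀ h, μ h ≠ 0 → ∃ s, h = lo * j + K * s)
    (hR2 : 2 ≤ R) (hxR : x * (1 + R) ≤ R)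
    (hbound : ∀ l r : ℕ, 1 ≤ l → 2 * (l : ℝ) < T₀ → 0 < μ l → 1 ≤ r → 2 * (K : ℝ) * ((r : ℝ) - 1) < 3 * (T₀ - 2 * (l : ℝ)) →
      R * μ l ≤ μ (l + K * r)) :
    SDEC x ((lo + K) * j) μ := by
  have hK0 : (0 : ℝ) < K := by exact_mod_cast (lt_of_le_of_lt (Nat.zero_le lo) hloK)
  refine sdec_of_nearRoutes_charged x T₀ ((lo + K) * j) μ (fun T l => l + K * ⌈3 * (T - 2 * (l : ℝ)) / (2 * K)⌉₊) hx0 hx1 hμ0 hμM hμ1 hT hT0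
    hta ?_ ?_
  · intro T hTpos hTle l hl1 hlT hμl
    obtain ⟨s, hs⟩ := hsupp l hμl.ne'
    have hlj : lo * j ≤ l := by rw [hs]; exact Nat.le_add_right _ _
    have hljR : (lo : ℝ) * j ≤ l := by exact_mod_cast hlj
    set A : ℝ := 3 * (T - 2 * (l : ℝ)) / (2 * K) with hA
    have hA0 : 0 < A := by rw [hA]; exact div_pos (by linarith) (by linarith)
    set r : ℕ := ⌈A⌉₊ with hr
    have hrA : A ≤ r := Nat.le_ceil A
    have hrA1 : (r : ℝ) < A + 1 := Nat.ceil_lt_add_one hA0.le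
    have hr1 : 1 ≤ r := Nat.ceil_pos.2 hA0
    -- `K·r` against `D = T − 2l`
    have hKr_ge : 3 * (T - 2 * (l : ℝ)) / 2 ≤ K * r := by
      have : (K : ℝ) * A ≤ K * r := mul_le_mul_of_nonneg_left hrA hK0.le
      have e : (K : ℝ) * A = 3 * (T - 2 * (l : ℝ)) / 2 := by rw [hA]; field_simp
      linarith
    have hKr_lt : (K : ℝ) * r < 3 * (T - 2 * (l : ℝ)) / 2 + K := by
      have : (K : ℝ) * r < K * (A + 1) := mul_lt_mul_of_pos_left hrA1 hK0
      have e : (K : ℝ) * A = 3 * (T - 2 * (l : ℝ)) / 2 := by rw [hA]; field_simp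
      linarith
    -- nearness: `D ≤ 2l − 2K` from `l ≥ lo·j`, `T < (lo+K)j`, `(lo+K)j + 2K ≤ 4lo·j`
    have hD : T - 2 * (l : ℝ) < 2 * l - 2 * K := by linarith
    show l < l + K * r ∧ ((l + K * r : ℕ) : ℝ) < T ∧ T < (l : ℝ) + ((l + K * r : ℕ) : ℝ) ∧
      max x ((T - 2 * (l : ℝ)) / (((l + K * r : ℕ) : ℝ) - l)) * (μ l + μ (l + K * r)) ≤ μ (l + K * r)
    have ec : ((l + K * r : ℕ) : ℝ) = (l : ℝ) + K * r := by push_cast; ring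
    have hKr1 : 1 ≤ K * r := Nat.le_of_lt_succ (by nlinarith [hr1, hloK])
    refine ⟨by omega, ?_, ?_, ?_⟩
    · rw [ec]; linarith
    · rw [ec]; linarith
    · have ed : ((l + K * r : ℕ) : ℝ) - l = K * r := by rw [ec]; ring
      rw [ed]
      have hKr0 : (0 : ℝ) < K * r := by
        have : (1 : ℝ) ≤ r := by exact_mod_cast hr1
        nlinarith
      have hρ : (T - 2 * (l : ℝ)) / (K * r) ≤ 2 / 3 := by
        rw [div_le_iff₀ hKr0]; linarith
      have hb : R * μ l ≤ μ (l + K * r) := by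
        refine hbound l r hl1 (by linarith) hμl hr1 ?_
        have : 2 * (K : ℝ) * ((r : ℝ) - 1) < 2 * K * A := by nlinarith
        have e : 2 * (K : ℝ) * A = 3 * (T - 2 * (l : ℝ)) := by rw [hA]; field_simp
        linarith
      exact cap_of_routeBound hx0.le hR2 hxR hρ (hμ0 l) (hμ0 _) hb
  · -- injectivity on charged lows: along the progression the map shifts by `−2K` per step
    intro T hTpos hTle l l' hl1 hlT hμl hl1' hlT' hμl' heq
    obtain ⟨s, hs⟩ := hsupp l hμl.ne'
    obtain ⟨s', hs'⟩ := hsupp l' hμl'.ne'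
    have key : ∀ (l₁ : ℕ) (d : ℕ), 2 * (((l₁ + K * d : ℕ) : ℝ)) < T →
        (l₁ + K * d) + K * ⌈3 * (T - 2 * (((l₁ + K * d : ℕ) : ℝ))) / (2 * K)⌉₊ + 2 * K * d
          = l₁ + K * ⌈3 * (T - 2 * (l₁ : ℝ)) / (2 * K)⌉₊ := by
      intro l₁ d hlow
      have ecast : ((l₁ + K * d : ℕ) : ℝ) = (l₁ : ℝ) + K * d := by push_cast; ring
      have hA'0 : 0 ≤ 3 * (T - 2 * (((l₁ + K * d : ℕ) : ℝ))) / (2 * K) := div_nonneg (by linarith) (by linarith)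
      have e : 3 * (T - 2 * (l₁ : ℝ)) / (2 * K) = 3 * (T - 2 * (((l₁ + K * d : ℕ) : ℝ))) / (2 * K) + ((3 * d : ℕ) : ℝ) := by
        rw [ecast]; push_cast; field_simp; ring
      rw [e, Nat.ceil_add_natCast hA'0]
      ring
    rcases lt_trichotomy s s' with h | h | h
    · exfalso
      obtain ⟨d, hd⟩ : ∃ d, s' = s + d + 1 := ⟨s' - s - 1, by omega⟩
      have el' : l' = l + K * (d + 1) := by rw [hs', hs, hd]; ring
      have := key l (d + 1) (by rw [← el']; exact hlT')
      rw [← el'] at this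
      have hpos : 0 < 2 * K * (d + 1) := Nat.mul_pos (Nat.mul_pos two_pos (by omega)) (Nat.succ_pos d)
      omega
    · subst h
      rw [hs, hs']
    · exfalso
      obtain ⟨d, hd⟩ : ∃ d, s = s' + d + 1 := ⟨s - s' - 1, by omega⟩
      have el : l = l' + K * (d + 1) := by rw [hs, hs', hd]; ring
      have := key l' (d + 1) (by rw [← el]; exact hlT)
      rw [← el] at this
      have hpos : 0 < 2 * K * (d + 1) := Nat.mul_pos (Nat.mul_pos two_pos (by omega)) (Nat.succ_pos d)
      omega

/-! ### The route bound for `K ≤ 2lo`, widths `≥ 4` -/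

/-- **THE ROUTE BOUND for the hub of shape `(lo, K)`, `lo < K ≤ 2lo`, width `|P| ≥ 4`** (`1 ≤ o ≤` every odds): for every charged `l` with
`2l < (lo+K)|P|` and every `r ≥ 1` with `2Kr + 6l < 3(lo+K)|P| + 2K`: `2o·u(l) ≤ u(l + Kr)`.  (Index bookkeeping after cancelling `K`: the charged lows
have `4s < |P|`, the routes `4r + 12s < 3|P| + 4`, whence `2s + r + 1 ≤ |P|` and `3s + 2 ≤ |P|` — the two facts binomial unimodality needs.) [this work] -/
theorem sHub_routeBound_twoLo (lo K : ℕ) (hloK : lo < K) (hK2 : K ≤ 2 * lo) (o : ℝ) (ho1 : 1 ≤ o) (P : List ℝ)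
    (hP : ∀ γ ∈ P, 0 ≤ γ ∧ γ ≤ 1 ∧ o * (1 - γ) ≤ γ) (hj : 4 ≤ P.length)
    (l r : ℕ) (hl : sHub lo K P l ≠ 0) (h2l : 2 * l < (lo + K) * P.length) (hr : 1 ≤ r)
    (h4 : 2 * (K * r) + 6 * l < 3 * ((lo + K) * P.length) + 2 * K) :
    2 * o * sHub lo K P l ≤ sHub lo K P (l + K * r) := by
  obtain ⟨hsupp, hlr⟩ := sHub_struct lo K hloK o (by linarith) P hP
  obtain ⟨a0, _, _, _⟩ := sHub_laws lo K P (fun γ' h' => ⟨(hP γ' h').1, (hP γ' h').2.1⟩)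
  set j : ℕ := P.length with hj'
  obtain ⟨s, rfl, hsj⟩ := hsupp l hl
  -- index bookkeeping: cancel `K`
  have hKpos : 0 < K := lt_of_le_of_lt (Nat.zero_le lo) hloK
  have e1 : (lo + K) * j = lo * j + K * j := by ring
  rw [e1] at h2l h4
  have hKj : K * j ≤ 2 * (lo * j) := by
    have := Nat.mul_le_mul_right j hK2
    calc K * j ≤ 2 * lo * j := this
      _ = 2 * (lo * j) := by ring
  have h4K : K * (4 * s) < K * j := by
    have : 4 * (K * s) < K * j := by omega
    calc K * (4 * s) = 4 * (K * s) := by ring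
      _ < K * j := this
  have hs4 : 4 * s < j := Nat.lt_of_mul_lt_mul_left h4K
  have hB : K * (4 * r + 12 * s) < K * (3 * j + 4) := by
    have : 4 * (K * r) + 12 * (K * s) < 3 * (K * j) + 4 * K := by omega
    calc K * (4 * r + 12 * s) = 4 * (K * r) + 12 * (K * s) := by ring
      _ < 3 * (K * j) + 4 * K := this
      _ = K * (3 * j + 4) := by ring
  have hrs : 4 * r + 12 * s < 3 * j + 4 := Nat.lt_of_mul_lt_mul_left hB
  have hsr : s + r + s + 1 ≤ j := by omega
  have h3s : 3 * s + 2 ≤ j := by omega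
  -- dominance steps in `s`-indexing
  have hlr' : ∀ i : ℕ, o * ((j : ℝ) - i) * sHub lo K P (lo * j + K * i) ≤ ((i : ℝ) + 1) * sHub lo K P (lo * j + K * (i + 1)) := by
    intro i
    have := hlr (lo * j + K * i)
    push_cast at this
    have hK0 : (0 : ℝ) < K := by exact_mod_cast hKpos
    have e1 : o * (((lo : ℝ) + K) * j - ((lo : ℝ) * j + K * i)) = K * (o * ((j : ℝ) - i)) := by ring
    have e2 : ((lo : ℝ) * j + K * i + K - (lo : ℝ) * j) = K * ((i : ℝ) + 1) := by ring
    rw [e1, e2, show lo * j + K * i + K = lo * j + K * (i + 1) by ring] at this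
    have hu := a0 (lo * j + K * i)
    have hu' := a0 (lo * j + K * (i + 1))
    have : K * (o * ((j : ℝ) - i) * sHub lo K P (lo * j + K * i)) ≤ K * (((i : ℝ) + 1) * sHub lo K P (lo * j + K * (i + 1))) := by
      nlinarith
    exact le_of_mul_le_mul_left this hK0
  have chain := shape_chain lo K o ho1 j (sHub lo K P) a0 hlr' s (s + r) (by omega) (by omega)
  have hc1 : j.choose (s + 1) ≤ j.choose (s + r) := choose_ge_of_between j s (s + r) (by omega) (by omega)
  have hc2 : 2 * j.choose s ≤ j.choose (s + 1) := by
    have e := Nat.choose_succ_right_eq j s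
    have hss : 2 * (s + 1) ≤ j - s := by omega
    have h1 : (2 * j.choose s) * (s + 1) ≤ j.choose (s + 1) * (s + 1) := by
      rw [e, Nat.mul_comm 2, Nat.mul_assoc]
      exact Nat.mul_le_mul_left _ hss
    exact Nat.le_of_mul_le_mul_right h1 (Nat.succ_pos s)
  have hc : (2 : ℝ) * (j.choose s : ℝ) ≤ (j.choose (s + r) : ℝ) := by exact_mod_cast hc2.trans hc1
  have hcs : (0 : ℝ) < (j.choose s : ℝ) := by exact_mod_cast Nat.choose_pos (by omega)
  rw [show lo * j + K * s + K * r = lo * j + K * (s + r) by ring]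
  have hus := a0 (lo * j + K * s)
  have ho0 : 0 ≤ o * sHub lo K P (lo * j + K * s) := mul_nonneg (by linarith) hus
  have : (j.choose s : ℝ) * (2 * o * sHub lo K P (lo * j + K * s)) ≤ (j.choose s : ℝ) * sHub lo K P (lo * j + K * (s + r)) :=
    calc (j.choose s : ℝ) * (2 * o * sHub lo K P (lo * j + K * s)) = (2 * (j.choose s : ℝ)) * (o * sHub lo K P (lo * j + K * s)) := by ring
      _ ≤ (j.choose (s + r) : ℝ) * (o * sHub lo K P (lo * j + K * s)) := mul_le_mul_of_nonneg_right hc ho0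
      _ = o * (j.choose (s + r) : ℝ) * sHub lo K P (lo * j + K * s) := by ring
      _ ≤ (j.choose s : ℝ) * sHub lo K P (lo * j + K * (s + r)) := chain
  exact le_of_mul_le_mul_left this hcs

/-! ### The hub of every width `≥ 4` is SDEC, for every shape `lo < K ≤ 2lo` -/

/-- **THE SUB-FLOOR HUB OF SHAPE `(lo, K)`, `lo < K ≤ 2lo`, OF EVERY WIDTH `≥ 4` IS SDEC.**  For every list `P` of `j ≥ 4` gates with `lo ≤ Kγ`
(far-giant), `γ < 1` and `x(lo+K) ≤ lo + Kγ` (affordable) for `γ ∈ P`, and every floor `0 < x`: `SDEC x ((lo+K)j) (sHub lo K P)`.  (Pieces here have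
`γ ≥ lo/K ≥ 1/2`, so `o = max(1, x/(2(1−x)))` is below every odds; the nearness inequality holds since `(3lo − K)·4 ≥ 4lo ≥ 2K`.) [this work] -/
theorem sdec_sHub_wide (lo K : ℕ) (hloK : lo < K) (hK2 : K ≤ 2 * lo) {x : ℝ} (hx0 : 0 < x) :
    ∀ P : List ℝ, 4 ≤ P.length → (∀ γ ∈ P, (lo : ℝ) ≤ K * γ ∧ γ < 1 ∧ x * ((lo : ℝ) + K) ≤ lo + K * γ) →
    SDEC x ((lo + K) * P.length) (sHub lo K P) := by
  intro P hP4 hP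
  have hP2 : 2 ≤ P.length := le_trans (by norm_num) hP4
  have hKpos : 0 < K := lt_of_le_of_lt (Nat.zero_le lo) hloK
  have hKr : (0 : ℝ) < K := by exact_mod_cast hKpos
  have hloR : (0 : ℝ) ≤ lo := Nat.cast_nonneg lo
  have hK2R : (K : ℝ) ≤ 2 * lo := by exact_mod_cast hK2
  have hne : P ≠ [] := by rintro rfl; simp at hP2
  obtain ⟨γ₀, hγ₀⟩ := List.exists_mem_of_ne_nil P hne
  have hx1 : x < 1 := by
    obtain ⟨_, g2, g3⟩ := hP γ₀ hγ₀
    nlinarith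
  -- every piece gate is `≥ 1/2`
  have hhalf : ∀ γ ∈ P, 1 / 2 ≤ γ := by
    intro γ h
    have := (hP γ h).1
    nlinarith
  set j : ℕ := P.length with hjP
  have hP01 : ∀ γ ∈ P, 0 ≤ γ ∧ γ ≤ 1 := fun γ h => ⟨by linarith [hhalf γ h], (hP γ h).2.1.le⟩
  obtain ⟨a0, aM, a1, am⟩ := sHub_laws lo K P hP01
  set T₀ : ℝ := (P.map (fun γ => (lo : ℝ) + K * γ)).sum with hT₀
  obtain ⟨hlo', hhi'⟩ := shape_sum_bounds lo K x P (fun γ h => ⟨(hP γ h).2.1, (hP γ h).2.2⟩)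
  have hTtop : T₀ < ((lo : ℝ) + K) * j := hhi' hne hKpos
  have hj4 : (4 : ℝ) ≤ j := by exact_mod_cast hP4
  have hT0 : 0 < T₀ := by
    have : 0 < x * ((lo : ℝ) + K) * (j : ℝ) := by positivity
    linarith
  -- the constant `o = max(1, x/(2(1−x)))`
  set o : ℝ := max 1 (x / (2 * (1 - x))) with ho
  have ho1 : 1 ≤ o := le_max_left _ _
  have hodds : ∀ γ ∈ P, 0 ≤ γ ∧ γ ≤ 1 ∧ o * (1 - γ) ≤ γ := by
    intro γ h
    obtain ⟨g1, g2, g3⟩ := hP γ h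
    have gh := hhalf γ h
    refine ⟨by linarith, g2.le, ?_⟩
    rw [ho, max_mul_of_nonneg _ _ (by linarith : (0 : ℝ) ≤ 1 - γ)]
    refine max_le (by linarith) ?_
    -- `x(1−γ) ≤ 2γ(1−x)` from `x(lo+K) ≤ lo + Kγ ≤ 2γ(lo+K)/(1+γ)`
    have key : ((lo : ℝ) + K * γ) * (1 + γ) ≤ 2 * γ * ((lo : ℝ) + K) := by nlinarith
    have hx2 : x * (1 + γ) ≤ 2 * γ := by
      have h1 : x * ((lo : ℝ) + K) * (1 + γ) ≤ ((lo : ℝ) + K * γ) * (1 + γ) := mul_le_mul_of_nonneg_right g3 (by linarith)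
      have hlK : (0 : ℝ) < (lo : ℝ) + K := by linarith
      nlinarith
    rw [div_mul_eq_mul_div, div_le_iff₀ (by linarith)]
    nlinarith
  have hxR : x * (1 + 2 * o) ≤ 2 * o := by
    have : x / (2 * (1 - x)) ≤ o := le_max_right _ _
    rw [div_le_iff₀ (by linarith)] at this
    nlinarith
  have hwide : ((lo : ℝ) + K) * j + 2 * K ≤ 4 * ((lo : ℝ) * j) := by nlinarith
  obtain ⟨hsupp, _⟩ := sHub_struct lo K hloK o (by linarith) P hodds
  refine sdec_progressionLK_wide lo K j x T₀ (2 * o) (sHub lo K P) hloK hwide hx0 hx1 a0 aM a1 am hT0 hTtop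
    (by push_cast; nlinarith [hlo']) ?_ (by linarith) hxR ?_
  · intro h hh
    obtain ⟨s, hs, _⟩ := hsupp h hh
    exact ⟨s, hs⟩
  · intro l r _ hlT hμl hr h4
    have h2l : 2 * l < (lo + K) * j := by
      have : (2 : ℝ) * l < ((lo : ℝ) + K) * j := by linarith
      exact_mod_cast this
    have h4' : 2 * (K * r) + 6 * l < 3 * ((lo + K) * j) + 2 * K := by
      have : (2 : ℝ) * (K * r) + 6 * l < 3 * (((lo : ℝ) + K) * j) + 2 * K := by nlinarith
      exact_mod_cast this
    have := sHub_routeBound_twoLo lo K hloK hK2 o ho1 P hodds hP4 l r hμl.ne' h2l hr h4'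
    linarith

end LawDec
end Quant
end Summit.CriticalPhenomena.PercolationContinuityZ3.Theorems
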